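import Summits.CriticalPhenomena.PercolationContinuityZ3.Theorems.PercGamblersRuinBGNOffTheFloorSplit
import Summits.CriticalPhenomena.PercolationContinuityZ3.Theorems.PercGamblersRuinBGNOffTheFloorThreshold
import Summits.CriticalPhenomena.PercolationContinuityZ3.Theorems.PercNearOneGluingKNSlabBridge
import Summits.CriticalPhenomena.PercolationContinuityZ3.Theorems.PercNearOneGluingAssembly
import Summits.CriticalPhenomena.PercolationContinuityZ3.Theorems.PercNearOneGluingAdditiveGluingSuffices
import Summits.CriticalPhenomena.PercolationContinuityZ3.Theorems.PercNearOneGluingNoHeavyLowerTailSuffices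
import HarnessLib

/-!
# `BGNOffTheFloor` (stmt-CriticalPhenomena-7773) — bridges: the Kozma–Nitzan gluing family, and the weakest plane gluing

Crux `Summit.CriticalPhenomena.PercolationContinuityZ3.Theses.PercGamblersRuin.BGNOffTheFloor`
(route `PercGamblersRuin`, item stmt-CriticalPhenomena-7773), line `registered` (birth skeleton
`Cruxes/BGNOffTheFloor/Lines/birth.lean`, lead c6). Support lemmas (`--supports`), all proved.

Notation: `E(A, L) = {ω | ∃ y, y₀ = L ∧ ω ∈ {0 ⟷ y in {z | -A < z₀}}}` (climb event),
`e_n(a,b) = P_{p_c}(E(a n, b n))`, `f(A, L) = P_{p_c}(E(A, L))`, `OffFloorAt a b :≡ liminf_n e_n(a,b) = 0`;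
the crux is `∀ a < b, OffFloorAt a b`; `UnitRatioBGN :≡ ∃ b₀, liminf_m f(m, b₀ m) = 0` (registered
stub `stub_unitRatioBGN`); `PlaneGluing :≡ ∀ 1 ≤ a < b, n ≥ 1, e_n(a,b) · f((a+b) n, n) ≤ e_n(a,b+1)`
(registered stub `stub_planeGluing`, the separating-plane instance of Kozma–Nitzan's Conjecture 1).

## §1 The crux is dominated by every member of the Kozma–Nitzan gluing family (edges that are theorems in the tree)

Route `PercNearOneGluing` has its bridge `KNSlabBridge` (Kozma–Nitzan 2024, Theorem 6 at `d = 3`)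
and its assembly PROVED (`KNSlabBridge_proof`, `percNearOneGluing_assembly_proof`), so each of its open
cruxes implies `θ(p_c) = 0` on `ℤ³` and hence this crux (`OffFloor.bgnOffTheFloor_of_percolationContinuityZ3`):

* `bgnOffTheFloor_of_nearOneGluing` — `NearOneGluing` (stmt-CriticalPhenomena-4574, KN Conjecture 3) `→ BGNOffTheFloor`;
* `bgnOffTheFloor_of_additiveGluing` — `AdditiveGluing` (stmt-CriticalPhenomena-4576) `→ BGNOffTheFloor`;
* `bgnOffTheFloor_of_noHeavyLowerTail` — `NoHeavyLowerTail` (stmt-CriticalPhenomena-4575) `→ BGNOffTheFloor`;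
* `additiveGluing_of_knConjecture1`, `bgnOffTheFloor_of_knConjecture1` — Kozma–Nitzan's Conjecture 1
  itself (finite weighted graphs, `P(o ↔ b) ≥ P(o ↔ A) · min_a P(a ↔ b)`, typed min-free exactly as the
  hypothesis of `Cruxes/NearOneGluing/KnShorteningConj1GluingProof.lean`) implies `AdditiveGluing`
  (`(1 - x)(1 - y) ≥ 1 - x - y`) and hence the crux.

Consequence for the line: its glue stub `stub_planeGluing` is an instance of Conjecture 1, but
Conjecture 1 as a BRIDGE is idle — it closes the whole sub-problem by itself, in the tree. A planner who
files a conjecture bridge for this crux must file the PLANE INSTANCE (or the weakest form of §2), not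
Conjecture 1.

## §2 The weakest plane gluing that closes the composition

* `OffFloor.climbExtension_of_planeGluingEventually` — the ladder step `ClimbExtension` already follows,
  θ-blindly, from plane gluing UP TO A CONSTANT AND FOR LARGE `n` only:
  `∀ 1 ≤ a < b, ∃ C N, ∀ n ≥ N, e_n(a,b) · f((a+b) n, n) ≤ C · e_n(a,b+1)`
  (`PlaneGluingEventually`; same proof as `OffFloor.climbExtension_of_planeGluing`: if `θ(p_c) = 0` the
  conclusion holds outright, else `f((a+b) n, n) ≥ θ(p_c)/2` and `liminf = 0` transfers through the
  constant `2 C / θ(p_c)`);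
* `bgnOffTheFloor_of_unitRatioBGN_of_planeGluingEventually`,
  `bgnOffTheFloor_iff_unitRatioBGN_of_planeGluingEventually` — hence `UnitRatioBGN ∧ PlaneGluingEventually
  → BGNOffTheFloor` and, under `PlaneGluingEventually`, `BGNOffTheFloor ↔ UnitRatioBGN`;
* `planeGluingEventually_of_planeGluing` — the registered stub implies the weak form (`C = 1`, `N = 1`).

References: G. Kozma, S. Nitzan, *A reduction of the θ(p_c) = 0 problem to a conjectured inequality*,
arXiv:2401.12397 (2024), Conjecture 1 (p. 3), Conjecture 3 and Theorem 6 (p. 15);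
H. Duminil-Copin, V. Sidoravicius, V. Tassion, *Absence of infinite cluster for critical Bernoulli
percolation on slabs*, Comm. Pure Appl. Math. 69 (2016).
-/

noncomputable section

namespace Summit.CriticalPhenomena.PercolationContinuityZ3.Theorems

open MeasureTheory Filter Literature.Probability.Percolation Literature.Probability.LatticeModels
open scoped Topology

/-! ## §1 Dominance by the Kozma–Nitzan gluing family -/

/-- **`NearOneGluing → BGNOffTheFloor`** (stmt-CriticalPhenomena-4574 dominates stmt-CriticalPhenomena-7773):
Kozma–Nitzan's Conjecture 3 gives, by the proved `KNSlabBridge` (KN Theorem 6 at `d = 3`) and the proved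
assembly of route `PercNearOneGluing` (no slab percolates at `p_c(ℤ³)`, DST 2016), `θ(p_c) = 0` on `ℤ³`,
which implies the crux (`OffFloor.bgnOffTheFloor_of_percolationContinuityZ3`).
[cite: KozmaNitzan2024, Theorem 6 (p. 15)] -/
theorem bgnOffTheFloor_of_nearOneGluing (h : Theses.PercNearOneGluing.NearOneGluing) :
    Theses.PercGamblersRuin.BGNOffTheFloor :=
  OffFloor.bgnOffTheFloor_of_percolationContinuityZ3 (percNearOneGluing_assembly_proof KNSlabBridge_proof h)

/-- **`AdditiveGluing → BGNOffTheFloor`** (stmt-CriticalPhenomena-4576 dominates stmt-CriticalPhenomena-7773),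
through `additiveGluingSuffices_proof : AdditiveGluing → NearOneGluing`. [cite: KozmaNitzan2024, Theorem 6 (p. 15)] -/
theorem bgnOffTheFloor_of_additiveGluing (h : Theses.PercNearOneGluing.AdditiveGluing) :
    Theses.PercGamblersRuin.BGNOffTheFloor :=
  bgnOffTheFloor_of_nearOneGluing (additiveGluingSuffices_proof h)

/-- **`NoHeavyLowerTail → BGNOffTheFloor`** (stmt-CriticalPhenomena-4575 dominates stmt-CriticalPhenomena-7773),
through `noHeavyLowerTailSuffices_proof : NoHeavyLowerTail → NearOneGluing`. [cite: KozmaNitzan2024, Theorem 6 (p. 15)] -/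
theorem bgnOffTheFloor_of_noHeavyLowerTail (h : Theses.PercNearOneGluing.NoHeavyLowerTail) :
    Theses.PercGamblersRuin.BGNOffTheFloor :=
  bgnOffTheFloor_of_nearOneGluing (noHeavyLowerTailSuffices_proof h)

/-- **Kozma–Nitzan's Conjecture 1 implies `AdditiveGluing`**: from `P(o ↔ A) · (1 - t) ≤ P(o ↔ b)`
(Conjecture 1 with the common lower bound `1 - t` of the `P(a ↔ b)`) and `P(o ↔ A) ≤ 1`, `t ≥ 0`:
`P(o ↔ A) - t ≤ P(o ↔ A)(1 - t) ≤ P(o ↔ b)`. Conjecture 1 is typed min-free over `Fin n`, verbatim the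
hypothesis of `stub_conj1Gluing` of crux `NearOneGluing`'s line `kn_shortening_induction`.
[cite: KozmaNitzan2024, Conjecture 1 (p. 3)] -/
theorem additiveGluing_of_knConjecture1
    (hC1 : ∀ (n : ℕ) (w : Sym2 (Fin n) → unitInterval) (A : Finset (Fin n)) (o b : Fin n) (t : ℝ),
      (∀ a ∈ A, t ≤ (prodBernoulli w).real (openConn a b)) →
      (prodBernoulli w).real (⋃ a ∈ A, openConn o a) * t ≤ (prodBernoulli w).real (openConn o b)) :
    Theses.PercNearOneGluing.AdditiveGluing := by
  intro n w A o b t ht hab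
  have h1 := hC1 n w A o b (1 - t) fun a ha => hab a ha
  have hP1 : (prodBernoulli w).real (⋃ a ∈ A, openConn o a) ≤ 1 := measureReal_le_one
  nlinarith [mul_nonneg ht (sub_nonneg.2 hP1)]

/-- **Kozma–Nitzan's Conjecture 1 implies `BGNOffTheFloor`** — in the tree, through `AdditiveGluing`,
`NearOneGluing`, KN Theorem 6 and DST: as a bridge for this crux Conjecture 1 is idle (it closes the whole
sub-problem). [cite: KozmaNitzan2024, Conjecture 1 (p. 3) and Theorem 6 (p. 15)] -/
theorem bgnOffTheFloor_of_knConjecture1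
    (hC1 : ∀ (n : ℕ) (w : Sym2 (Fin n) → unitInterval) (A : Finset (Fin n)) (o b : Fin n) (t : ℝ),
      (∀ a ∈ A, t ≤ (prodBernoulli w).real (openConn a b)) →
      (prodBernoulli w).real (⋃ a ∈ A, openConn o a) * t ≤ (prodBernoulli w).real (openConn o b)) :
    Theses.PercGamblersRuin.BGNOffTheFloor :=
  bgnOffTheFloor_of_additiveGluing (additiveGluing_of_knConjecture1 hC1)

/-! ## §2 The weakest plane gluing that closes the composition -/

namespace OffFloor

/-- **Plane gluing up to a constant and for large `n` implies the ladder step, θ-blindly.** If for all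
`1 ≤ a < b` there are `C`, `N` with `e_n(a,b) · f((a+b) n, n) ≤ C · e_n(a,b+1)` for all `n ≥ N`, then for
`1 ≤ a < b`, `liminf_n e_n(a,b+1) = 0 → liminf_n e_n(a,b) = 0`. Cases: `θ(p_c) = 0` gives the
conclusion outright (`offFloor_of_theta_eq_zero`); `θ(p_c) > 0` gives `f((a+b) n, n) ≥ f(n,n) ≥ θ(p_c)/2`
(`climb_real_mono`, `theta_le_two_mul_climb_diag`), hence `e_n(a,b) ≤ (2 max(C,1)/θ) e_n(a,b+1)` for
`n ≥ N`. [folklore] -/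
theorem climbExtension_of_planeGluingEventually
    (hplane : ∀ a b : ℕ, 1 ≤ a → a < b → ∃ C : ℝ, ∃ N : ℕ, ∀ n : ℕ, N ≤ n →
      (bondPercolation (zdGraph 3) (criticalProbI 3)).real
          {ω | ∃ y : Site 3, y 0 = ((b * n : ℕ) : ℤ) ∧
            ω ∈ openConnIn {z : Site 3 | -((a * n : ℕ) : ℤ) < z 0} 0 y} *
        (bondPercolation (zdGraph 3) (criticalProbI 3)).real
          {ω | ∃ y : Site 3, y 0 = ((n : ℕ) : ℤ) ∧
            ω ∈ openConnIn {z : Site 3 | -(((a + b) * n : ℕ) : ℤ) < z 0} 0 y} ≤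
      C * (bondPercolation (zdGraph 3) (criticalProbI 3)).real
          {ω | ∃ y : Site 3, y 0 = (((b + 1) * n : ℕ) : ℤ) ∧
            ω ∈ openConnIn {z : Site 3 | -((a * n : ℕ) : ℤ) < z 0} 0 y}) :
    ∀ a b : ℕ, 1 ≤ a → a < b →
      (∀ ε : ℝ, 0 < ε → ∃ᶠ n : ℕ in atTop,
        (bondPercolation (zdGraph 3) (criticalProbI 3)).real
            {ω | ∃ y : Site 3, y 0 = (((b + 1) * n : ℕ) : ℤ) ∧
              ω ∈ openConnIn {z : Site 3 | -((a * n : ℕ) : ℤ) < z 0} 0 y} < ε) →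
      ∀ ε : ℝ, 0 < ε → ∃ᶠ n : ℕ in atTop,
        (bondPercolation (zdGraph 3) (criticalProbI 3)).real
            {ω | ∃ y : Site 3, y 0 = ((b * n : ℕ) : ℤ) ∧
              ω ∈ openConnIn {z : Site 3 | -((a * n : ℕ) : ℤ) < z 0} 0 y} < ε := by
  intro a b ha hab hhyp ε hε
  by_cases hθ : theta (zdGraph 3) 0 (criticalProbI 3) = 0
  · exact offFloor_of_theta_eq_zero hθ a b (by omega) ε hε
  · set θ := theta (zdGraph 3) 0 (criticalProbI 3) with hθdef
    have hθpos : 0 < θ := lt_of_le_of_ne measureReal_nonneg (Ne.symm hθ)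
    obtain ⟨C, N, hC⟩ := hplane a b ha hab
    set C' : ℝ := max C 1 with hC'def
    have hC'pos : 0 < C' := lt_of_lt_of_le one_pos (le_max_right C 1)
    refine ((hhyp (ε * θ / (2 * C')) (by positivity)).and_eventually
      (eventually_ge_atTop (max N 1))).mono ?_
    rintro n ⟨hn, hn1⟩
    have hnN : N ≤ n := le_trans (le_max_left _ _) hn1
    have hn1' : 1 ≤ n := le_trans (le_max_right _ _) hn1
    have hpl := hC n hnN
    have hdiag := theta_le_two_mul_climb_diag n hn1'
    have hmono : (bondPercolation (zdGraph 3) (criticalProbI 3)).real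
          {ω | ∃ y : Site 3, y 0 = (n : ℤ) ∧ ω ∈ openConnIn {z : Site 3 | -(n : ℤ) < z 0} 0 y} ≤
        (bondPercolation (zdGraph 3) (criticalProbI 3)).real
          {ω | ∃ y : Site 3, y 0 = ((n : ℕ) : ℤ) ∧
            ω ∈ openConnIn {z : Site 3 | -(((a + b) * n : ℕ) : ℤ) < z 0} 0 y} := by
      refine climb_real_mono (criticalProbI 3) (A := (n : ℤ)) (A' := (((a + b) * n : ℕ) : ℤ))
        (L := (n : ℤ)) (L' := (n : ℤ)) ?_ (by positivity) le_rfl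
      have : n ≤ (a + b) * n := Nat.le_mul_of_pos_left n (by omega)
      exact_mod_cast this
    -- abbreviate the three probabilities
    set X := (bondPercolation (zdGraph 3) (criticalProbI 3)).real
        {ω | ∃ y : Site 3, y 0 = ((b * n : ℕ) : ℤ) ∧
          ω ∈ openConnIn {z : Site 3 | -((a * n : ℕ) : ℤ) < z 0} 0 y} with hX
    set Y := (bondPercolation (zdGraph 3) (criticalProbI 3)).real
        {ω | ∃ y : Site 3, y 0 = ((n : ℕ) : ℤ) ∧
          ω ∈ openConnIn {z : Site 3 | -(((a + b) * n : ℕ) : ℤ) < z 0} 0 y} with hY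
    set Z := (bondPercolation (zdGraph 3) (criticalProbI 3)).real
        {ω | ∃ y : Site 3, y 0 = (((b + 1) * n : ℕ) : ℤ) ∧
          ω ∈ openConnIn {z : Site 3 | -((a * n : ℕ) : ℤ) < z 0} 0 y} with hZ
    have hYge : θ / 2 ≤ Y := by linarith
    have hY0 : 0 < Y := by linarith
    have hZ0 : 0 ≤ Z := measureReal_nonneg
    have hCZ : C * Z ≤ C' * Z := mul_le_mul_of_nonneg_right (le_max_left C 1) hZ0
    have hXY : X * Y < ε * Y := by
      calc X * Y ≤ C * Z := hpl
        _ ≤ C' * Z := hCZ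
        _ < C' * (ε * θ / (2 * C')) := mul_lt_mul_of_pos_left hn hC'pos
        _ = ε * (θ / 2) := by field_simp
        _ ≤ ε * Y := mul_le_mul_of_nonneg_left hYge hε.le
    exact lt_of_mul_lt_mul_right hXY hY0.le

end OffFloor

/-- **The registered stub implies the weak form** (`C = 1`, `N = 1`). [folklore] -/
theorem planeGluingEventually_of_planeGluing
    (hplane : ∀ a b n : ℕ, 1 ≤ a → a < b → 1 ≤ n →
      (bondPercolation (zdGraph 3) (criticalProbI 3)).real
          {ω | ∃ y : Site 3, y 0 = ((b * n : ℕ) : ℤ) ∧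
            ω ∈ openConnIn {z : Site 3 | -((a * n : ℕ) : ℤ) < z 0} 0 y} *
        (bondPercolation (zdGraph 3) (criticalProbI 3)).real
          {ω | ∃ y : Site 3, y 0 = ((n : ℕ) : ℤ) ∧
            ω ∈ openConnIn {z : Site 3 | -(((a + b) * n : ℕ) : ℤ) < z 0} 0 y} ≤
      (bondPercolation (zdGraph 3) (criticalProbI 3)).real
          {ω | ∃ y : Site 3, y 0 = (((b + 1) * n : ℕ) : ℤ) ∧
            ω ∈ openConnIn {z : Site 3 | -((a * n : ℕ) : ℤ) < z 0} 0 y}) :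
    ∀ a b : ℕ, 1 ≤ a → a < b → ∃ C : ℝ, ∃ N : ℕ, ∀ n : ℕ, N ≤ n →
      (bondPercolation (zdGraph 3) (criticalProbI 3)).real
          {ω | ∃ y : Site 3, y 0 = ((b * n : ℕ) : ℤ) ∧
            ω ∈ openConnIn {z : Site 3 | -((a * n : ℕ) : ℤ) < z 0} 0 y} *
        (bondPercolation (zdGraph 3) (criticalProbI 3)).real
          {ω | ∃ y : Site 3, y 0 = ((n : ℕ) : ℤ) ∧
            ω ∈ openConnIn {z : Site 3 | -(((a + b) * n : ℕ) : ℤ) < z 0} 0 y} ≤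
      C * (bondPercolation (zdGraph 3) (criticalProbI 3)).real
          {ω | ∃ y : Site 3, y 0 = (((b + 1) * n : ℕ) : ℤ) ∧
            ω ∈ openConnIn {z : Site 3 | -((a * n : ℕ) : ℤ) < z 0} 0 y} :=
  fun a b ha hab => ⟨1, 1, fun n hn => by simpa only [one_mul] using hplane a b n ha hab hn⟩

/-- **`UnitRatioBGN ∧ PlaneGluingEventually → BGNOffTheFloor`**: the weak gluing yields the ladder step
(`OffFloor.climbExtension_of_planeGluingEventually`), and the ladder step is exactly the implication
`UnitRatioBGN → BGNOffTheFloor` (`OffFloor.climbExtension_iff_unit_imp`). [folklore] -/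
theorem bgnOffTheFloor_of_unitRatioBGN_of_planeGluingEventually
    (hunit : ∃ b₀ : ℕ, ∀ ε : ℝ, 0 < ε → ∃ᶠ m : ℕ in atTop,
      (bondPercolation (zdGraph 3) (criticalProbI 3)).real
        {ω | ∃ y : Site 3, y 0 = ((b₀ * m : ℕ) : ℤ) ∧
          ω ∈ openConnIn {z : Site 3 | -((m : ℕ) : ℤ) < z 0} 0 y} < ε)
    (hplane : ∀ a b : ℕ, 1 ≤ a → a < b → ∃ C : ℝ, ∃ N : ℕ, ∀ n : ℕ, N ≤ n →
      (bondPercolation (zdGraph 3) (criticalProbI 3)).real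
          {ω | ∃ y : Site 3, y 0 = ((b * n : ℕ) : ℤ) ∧
            ω ∈ openConnIn {z : Site 3 | -((a * n : ℕ) : ℤ) < z 0} 0 y} *
        (bondPercolation (zdGraph 3) (criticalProbI 3)).real
          {ω | ∃ y : Site 3, y 0 = ((n : ℕ) : ℤ) ∧
            ω ∈ openConnIn {z : Site 3 | -(((a + b) * n : ℕ) : ℤ) < z 0} 0 y} ≤
      C * (bondPercolation (zdGraph 3) (criticalProbI 3)).real
          {ω | ∃ y : Site 3, y 0 = (((b + 1) * n : ℕ) : ℤ) ∧
            ω ∈ openConnIn {z : Site 3 | -((a * n : ℕ) : ℤ) < z 0} 0 y}) :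
    Theses.PercGamblersRuin.BGNOffTheFloor :=
  OffFloor.climbExtension_iff_unit_imp.1 (OffFloor.climbExtension_of_planeGluingEventually hplane) hunit

/-- **Under the weak gluing the crux is its existential shadow**:
`PlaneGluingEventually → (BGNOffTheFloor ↔ UnitRatioBGN)`. [folklore] -/
theorem bgnOffTheFloor_iff_unitRatioBGN_of_planeGluingEventually
    (hplane : ∀ a b : ℕ, 1 ≤ a → a < b → ∃ C : ℝ, ∃ N : ℕ, ∀ n : ℕ, N ≤ n →
      (bondPercolation (zdGraph 3) (criticalProbI 3)).real
          {ω | ∃ y : Site 3, y 0 = ((b * n : ℕ) : ℤ) ∧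
            ω ∈ openConnIn {z : Site 3 | -((a * n : ℕ) : ℤ) < z 0} 0 y} *
        (bondPercolation (zdGraph 3) (criticalProbI 3)).real
          {ω | ∃ y : Site 3, y 0 = ((n : ℕ) : ℤ) ∧
            ω ∈ openConnIn {z : Site 3 | -(((a + b) * n : ℕ) : ℤ) < z 0} 0 y} ≤
      C * (bondPercolation (zdGraph 3) (criticalProbI 3)).real
          {ω | ∃ y : Site 3, y 0 = (((b + 1) * n : ℕ) : ℤ) ∧
            ω ∈ openConnIn {z : Site 3 | -((a * n : ℕ) : ℤ) < z 0} 0 y}) :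
    Theses.PercGamblersRuin.BGNOffTheFloor ↔
      ∃ b₀ : ℕ, ∀ ε : ℝ, 0 < ε → ∃ᶠ m : ℕ in atTop,
        (bondPercolation (zdGraph 3) (criticalProbI 3)).real
          {ω | ∃ y : Site 3, y 0 = ((b₀ * m : ℕ) : ℤ) ∧
            ω ∈ openConnIn {z : Site 3 | -((m : ℕ) : ℤ) < z 0} 0 y} < ε :=
  ⟨unitRatioBGN_of_bgnOffTheFloor,
    fun hunit => bgnOffTheFloor_of_unitRatioBGN_of_planeGluingEventually hunit hplane⟩

/-! ## The two registered structural stubs of line `registered` (lead c6 reshape), signatures verbatim -/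

/-- **Registered STUB 10 `stub_nearOneGluingDominates` of line `registered` (birth) of `BGNOffTheFloor`,
signature verbatim**: the crux `NearOneGluing` (stmt-CriticalPhenomena-4574) of route `PercNearOneGluing`
implies this crux (`bgnOffTheFloor_of_nearOneGluing`). [cite: KozmaNitzan2024, Theorem 6 (p. 15)] -/
theorem stub_nearOneGluingDominates :
    Summit.CriticalPhenomena.PercolationContinuityZ3.Theses.PercNearOneGluing.NearOneGluing →
    Summit.CriticalPhenomena.PercolationContinuityZ3.Theses.PercGamblersRuin.BGNOffTheFloor :=
  fun h => bgnOffTheFloor_of_nearOneGluing h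

/-- **Registered STUB 11 `stub_splitGlueEventually` of line `registered` (birth) of `BGNOffTheFloor`,
signature verbatim**: `UnitRatioBGN → PlaneGluingEventually → BGNOffTheFloor`
(`bgnOffTheFloor_of_unitRatioBGN_of_planeGluingEventually`). [folklore] -/
theorem stub_splitGlueEventually :
    (∃ b₀ : ℕ, ∀ ε : ℝ, 0 < ε → ∃ᶠ m : ℕ in atTop,
      (bondPercolation (zdGraph 3) (criticalProbI 3)).real
        {ω | ∃ y : Site 3, y 0 = ((b₀ * m : ℕ) : ℤ) ∧
          ω ∈ openConnIn {z : Site 3 | -((m : ℕ) : ℤ) < z 0} 0 y} < ε) →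
    (∀ a b : ℕ, 1 ≤ a → a < b → ∃ C : ℝ, ∃ N : ℕ, ∀ n : ℕ, N ≤ n →
      (bondPercolation (zdGraph 3) (criticalProbI 3)).real
          {ω | ∃ y : Site 3, y 0 = ((b * n : ℕ) : ℤ) ∧
            ω ∈ openConnIn {z : Site 3 | -((a * n : ℕ) : ℤ) < z 0} 0 y} *
        (bondPercolation (zdGraph 3) (criticalProbI 3)).real
          {ω | ∃ y : Site 3, y 0 = ((n : ℕ) : ℤ) ∧
            ω ∈ openConnIn {z : Site 3 | -(((a + b) * n : ℕ) : ℤ) < z 0} 0 y} ≤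
      C * (bondPercolation (zdGraph 3) (criticalProbI 3)).real
          {ω | ∃ y : Site 3, y 0 = (((b + 1) * n : ℕ) : ℤ) ∧
            ω ∈ openConnIn {z : Site 3 | -((a * n : ℕ) : ℤ) < z 0} 0 y}) →
    Summit.CriticalPhenomena.PercolationContinuityZ3.Theses.PercGamblersRuin.BGNOffTheFloor :=
  fun hunit hplane => bgnOffTheFloor_of_unitRatioBGN_of_planeGluingEventually hunit hplane

end Summit.CriticalPhenomena.PercolationContinuityZ3.Theorems

end
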